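import Literature.AnabelianGeometry.EtaleTheta.Discharge.Sec5ToyNineFacts

/-!
# [EtTh] §5 ↔ §2 dictionary of Lemma 5.9 (iv): JOINTLY SATISFIABLE WITH A NON-TRIVIAL THETA CLASS — `ρ|_{Π^tp_Ÿ̲}`, `s^⊔_N·s^⊓_N⁻¹`,
# the bi-Kummer difference cocycle and the class of `η̈^Θ` all non-trivial at one closed datum (PROOF-ONLY; pp. 331–332 / PDF pp. 105–106)

Mochizuki, *The étale theta function and its Frobenioid-theoretic manifestations*, Publ. RIMS **45** (2009)
[cite: MochizukiEtTh2009, Lem 5.9 (iv) p.332 (PDF p.106); Lem 5.8 p.331 (PDF p.105); Prop 5.2 (iii) p.324 (PDF p.98)].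
abc-iut cell, block F, seat abc-iut-f-116 (gen 3), tranche 116 of `plan/F-TRANCHES.tsv` (rows F-1306 `CyclotomicCharacterCompatX`,
F-0521 `ThetaSectionCompat`, F-0520 `KummerOutReached` of abc-iut-L2-t11's `Discharge/Sec5EnvelopeTopology.lean`).  PROOF-ONLY
(0 `def`, 0 instance, 0 `Prop` fact; nothing landed is edited); SEQUEL to this seat's gen-2 `Sec5DictionaryJointWitness.lean`
(p436178): there the whole hypothesis list of abc-iut-L2-t11's `envIsoBiTheta_of` was verified at toy no. 3, whose `ρ` kills
`Π^tp_Ÿ̲`, so that every admissible theta cocycle dies and `η̈^Θ mod 3 := {1}` was FORCED (second-read note of abc-iut-w5-d070: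
"non-trivial" there = the CHARACTER only).  Here the same list is verified at toy no. 9 (`FrobenioidThetaToyNine.lean`,
`Sec5ToyNineFacts.lean`), where the theta CLASS is non-trivial.

WHAT IS PROVED, at `toy₉` / `env₉` with `ι := id`, `m := muEquiv₉`, `DK := ∅`:
* NON-DEGENERACY: `rho_yOne_ne_one` (`ρ` is non-trivial on `Π^tp_Ÿ̲`), `sCup_ne_sCap` (`s^⊔_N ≠ s^⊓_N`),
  `exists_sgpCup_ne_sgpCap` (`s^⊔-gp_N ≠ s^⊓-gp_N|_{H_{B_N}}`), `diffCocycle_yOne_ne_one` (the bi-Kummer difference cocycle of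
  Prop. 4.3 (iii) is non-trivial), `eta₉_yOne_ne_one` / `eta₉_ne_coboundary` / `coboundary_not_mem_thetaCocycles` (the theta
  cocycle `η₉` is non-trivial and NOT a coboundary: the CLASS `η̈^Θ mod 3` is non-zero), and the character inverts `μ₃`;
* the dictionary: `identifiesPiY_toy₉`, `identifiesPiYdd_toy₉` (`Iff.rfl`), F-1306 / F-0521 from `Sec5ToyNineFacts.lean`,
  **`kummerOutReached_toy₉`** (F-0520 with `DK := ∅`: `kummerShift_eq_one`, `H¹(ℤˣ, ℤ/3(χ)) = 0`, every Kummer shift is inner),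
  **`constOutTransported_toy₉`** (the constants `(O_K^×)^{1/3} = μ_3(B_N)` act by inner automorphisms);
* CONSEQUENTLY, by abc-iut-L2-t11's `envIsoBiTheta_of` and abc-iut-L2-t4's `frdIsMonoThetaEnv_of` BY NAME: **`envIsoBiTheta_toy₉`**
  (F-0545) and **`frdIsMonoThetaEnv_toy₉`** (F-0546) — "the natural inclusions `μ_N(B_N) ↪ E_N`, `Im(Π^tp_Y) ⊆ E_N` determine an
  isomorphism of topological groups `E^Π_N ⥲ Π^tp_Y[μ_N]` which is an isomorphism of mod `N` bi-theta environments", with the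
  theta section `s^Θ_Ÿ = η₉⁻¹·s^alg_Ÿ` built from a NON-TRIVIAL class, REALISED in the kernel on closed data;
* `exists_dictionaryThetaClassWitness` — the packaged joint statement (one citation for the FACT-LIST witness column).
HONEST FRAMING: a consistency / non-vacuity witness for OUR typed hypothesis list; the toy is not the genuine Tate-curve data
and asserts nothing about [EtTh] (a refereed paper); typed ≠ proved; no side is taken on [IUTchIII] Cor. 3.12.
-/

namespace Literature.AnabelianGeometry.EtaleTheta

open CategoryTheory
open Literature.AlgebraicGeometry.Frobenioids

namespace ThetaFrobenioid

namespace Toy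

/-! ### Non-degeneracy: `ρ|Π^tp_Ÿ̲`, `s^⊔_N ≠ s^⊓_N`, the difference cocycle and the theta CLASS are all non-trivial -/

/-- The element `y₁ := (0, 1, id)` lies in `Π^tp_Ÿ̲`. [cite: MochizukiEtTh2009, §5 p.332 (PDF p.106)] -/
theorem yOne_mem : ((1, (Multiplicative.ofAdd 1, 1)) : Pi) ∈ piYdd :=
  ⟨Subgroup.mem_comap.mpr (by change (1 : Equiv.Perm (Fin 3)) ∈ alternatingGroup (Fin 3); exact one_mem _),
    MonoidHom.mem_ker.mpr rfl⟩

/-- **`ρ` is NON-TRIVIAL on `Π^tp_Ÿ̲`** in toy no. 9 (`ρ₀(y₁) = (1 mod 3, +1)`): the bi-Kummer data over `H_{B_N}`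
are not vacuous.  [cite: MochizukiEtTh2009, §5 p.331 (PDF p.105)] -/
theorem rho_yOne_ne_one : toy₉.ρ ((1, (Multiplicative.ofAdd 1, 1)) : Pi) ≠ 1 := by
  intro h
  have h1 : rho₉ ((1, (Multiplicative.ofAdd 1, 1)) : Pi) = 1 := (MulEquiv.map_eq_one_iff (autEquiv H₉)).mp h
  have h2 := congrArg Prod.fst h1
  change Multiplicative.ofAdd (((Multiplicative.toAdd (Multiplicative.ofAdd (1 : ℤ))) : ℤ) : ZMod 3) = 1 at h2
  exact absurd h2 (by decide)

/-- **The theta cocycle `η₉` is non-trivial**: `η₉(y₁) = 1 mod 3 ≠ 0`. [cite: MochizukiEtTh2009, Prop 5.2 (iii) p.324 (PDF p.98)] -/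
theorem eta₉_yOne_ne_one : eta₉Hom ⟨((1, (Multiplicative.ofAdd 1, 1)) : Pi), yOne_mem⟩ ≠ 1 := by
  change Multiplicative.ofAdd (((Multiplicative.toAdd (Multiplicative.ofAdd (1 : ℤ))) : ℤ) : ZMod 3) ≠ 1
  decide

/-- Every §2 coboundary VANISHES on `Π^tp_Ÿ` (the character is trivial there). [cite: MochizukiEtTh2009, §2 p.273 (PDF p.47)] -/
theorem coboundary_piYdd_eq_one (c : Multiplicative (ZMod 3)) :
    CycEnvelope.coboundary (env₉.aug.comp env₉.PiYdd.subtype) env₉.chi c = 1 := by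
  funext g
  change c * (invAction _ (Equiv.Perm.sign (s3 (g : Pi))) c)⁻¹ = 1
  rw [sign_s3_piYdd g, map_one, MulAut.one_apply, mul_inv_cancel]

/-- **The theta CLASS of toy no. 9 is NON-TRIVIAL**: `η₉` is not a coboundary (so `η̈^Θ mod 3 = {η₉}` is a
non-zero class in `H¹(Π^tp_Ÿ, μ₃)`).  [cite: MochizukiEtTh2009, Prop 5.2 (iii) p.324 (PDF p.98)] -/
theorem eta₉_ne_coboundary (c : Multiplicative (ZMod 3)) :
    (⇑eta₉Hom : env₉.PiYdd → env₉.mu) ≠ CycEnvelope.coboundary (env₉.aug.comp env₉.PiYdd.subtype) env₉.chi c := by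
  rw [coboundary_piYdd_eq_one]
  intro h
  exact eta₉_yOne_ne_one (congrFun h ⟨((1, (Multiplicative.ofAdd 1, 1)) : Pi), yOne_mem⟩)

/-- `η̈^Θ mod 3` of toy no. 9 contains NO coboundary. [cite: MochizukiEtTh2009, Prop 5.2 (iii) p.324 (PDF p.98)] -/
theorem coboundary_not_mem_thetaCocycles (c : Multiplicative (ZMod 3)) :
    CycEnvelope.coboundary (env₉.aug.comp env₉.PiYdd.subtype) env₉.chi c ∉ env₉.thetaCocycles := by
  intro h
  exact eta₉_ne_coboundary c (Set.mem_singleton_iff.mp h).symm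

/-- **The bi-Kummer difference cocycle of toy no. 9 is NON-TRIVIAL**: `s^⊔-gp_N(ρ y₁)·s^⊓-gp_N(ρ y₁)⁻¹ = 1 − 4 = 6 ∈ ℤ/9`.
[cite: MochizukiEtTh2009, Prop 4.3 (iii) p.317 (PDF p.91)] -/
theorem diffCocycle_yOne_ne_one (H : toy₉.Facts) : toy₉.diffCocycle H ⟨((1, (Multiplicative.ofAdd 1, 1)) : Pi), yOne_mem⟩ ≠ 1 := by
  intro h
  have h1 := thetaSectionCompat_toy₉ H ⟨((1, (Multiplicative.ofAdd 1, 1)) : Pi), yOne_mem⟩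
  rw [h, map_one] at h1
  exact eta₉_yOne_ne_one (inv_eq_one.mp h1.symm)

/-- **`s^⊔-gp_N ≠ s^⊓-gp_N|_{H_{B_N}}`** in toy no. 9. [cite: MochizukiEtTh2009, §5 p.331 (PDF p.105)] -/
theorem exists_sgpCup_ne_sgpCap :
    ∃ h : toy₉.HB, toy₉.sgpCup h ≠ toy₉.sgpCap (h : Aut (toy₉.base.obj toy₉.BN)) :=
  ⟨toy₉.rhoYdd ⟨((1, (Multiplicative.ofAdd 1, 1)) : Pi), yOne_mem⟩, fun h => diffCocycle_yOne_ne_one facts_toy₉ (Subtype.ext (by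
    change toy₉.sgpCup _ * (toy₉.sgpCap _)⁻¹ = 1
    rw [h, mul_inv_cancel]))⟩

/-- **`s^⊔_N ≠ s^⊓_N`** in toy no. 9 (they are "base-equivalent", as print requires, and distinct).
[cite: MochizukiEtTh2009, §5 p.330 (PDF p.104)] -/
theorem sCup_ne_sCap : toy₉.sCup ≠ toy₉.sCap := by
  intro h
  have h1 := congrArg SemidirectProduct.left (h : wElt = (1 : G₉))
  change (SemidirectProduct.inl (Multiplicative.ofAdd (1 : ZMod 9)) : G₉).left = (1 : G₉).left at h1
  rw [SemidirectProduct.left_inl, SemidirectProduct.one_left] at h1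
  exact absurd h1 (by decide)

/-! ### Lemma 5.9 (iv) at toy no. 9: the whole dictionary, `DK := ∅` -/

/-- `ι := id` identifies `Π^tp_Y̲` with `Π^tp_Y` (the same subgroup). [cite: MochizukiEtTh2009, Lem 5.9 (iv) p.332 (PDF p.106)] -/
theorem identifiesPiY_toy₉ : toy₉.IdentifiesPiY env₉ (MulEquiv.refl _) := fun _ => Iff.rfl

/-- `ι := id` identifies `Π^tp_Ÿ̲` with `Π^tp_Ÿ`. [cite: MochizukiEtTh2009, Lem 5.9 (iv) p.332 (PDF p.106)] -/
theorem identifiesPiYdd_toy₉ : toy₉.IdentifiesPiYdd env₉ (MulEquiv.refl _) := fun _ => Iff.rfl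

/-- Every Kummer shift of `Π^tp_Y[μ₃]` for toy §2 datum no. 9 is INNER: `H¹(ℤˣ, ℤ/3(χ)) = 0` for the inversion character
(the cocycle `δ` is the coboundary of `δ(−1)⁻¹`).  [cite: MochizukiEtTh2009, Def 2.13 (i) p.273 (PDF p.47)] -/
theorem kummerShift_eq_one :
    letI : TopologicalSpace toy₉.PiX := toy₉.instTopPiX
    letI : TopologicalSpace (Multiplicative (ZMod 3)) := ⊥
    ∀ (δ : env₉.G → env₉.mu) (hδ : CycEnvelope.IsEnvCocycle env₉.augY env₉.chi (δ ∘ env₉.augY))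
      (hc : CycEnvelope.shift hδ ∈ contMulAut env₉.env), TopOut.mk _ ⟨CycEnvelope.shift hδ, hc⟩ = 1 := by
  letI : TopologicalSpace toy₉.PiX := toy₉.instTopPiX
  letI : TopologicalSpace (Multiplicative (ZMod 3)) := ⊥
  intro δ hδ hc
  have h1 : δ 1 = 1 := by
    have := hδ 1 1
    simp only [Function.comp_apply, mul_one, map_one, MulAut.one_apply] at this
    exact mul_eq_left.mp this.symm
  have hsq : ∀ c : Multiplicative (ZMod 3), c⁻¹ * c⁻¹ = c := by decide
  set a : env₉.mu := (δ (-1))⁻¹ with ha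
  have hfun : ∀ p : env₉.PiY, δ (env₉.augY p) = CycEnvelope.coboundary env₉.augY env₉.chi a p := by
    intro p
    rcases Int.units_eq_one_or (env₉.augY p) with hp | hp
    · rw [hp, h1]
      simp [CycEnvelope.coboundary, hp]
    · rw [hp]
      simp only [CycEnvelope.coboundary, hp]
      change δ (-1) = (δ (-1))⁻¹ * ((δ (-1))⁻¹ ^ (((-1 : ℤˣ) : ℤ)))⁻¹
      rw [Units.val_neg, Units.val_one, zpow_neg_one, inv_inv, hsq]
  have hshift : CycEnvelope.shift hδ = MulAut.conj (CycEnvelope.inMu env₉.augY env₉.chi a) := by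
    apply MulEquiv.ext
    intro x
    rw [CycEnvelope.conj_inMu_eq_shift_coboundary]
    refine SemidirectProduct.ext ?_ rfl
    change x.left * (δ ∘ env₉.augY) x.right = x.left * CycEnvelope.coboundary env₉.augY env₉.chi a x.right
    rw [Function.comp_apply, hfun]
  refine (QuotientGroup.eq_one_iff _).mpr ?_
  rw [Subgroup.mem_subgroupOf]
  exact ⟨CycEnvelope.inMu env₉.augY env₉.chi a, hshift.symm⟩

/-- **F-0520 `KummerOutReached` at toy no. 9 with `DK := ∅`**: every Kummer outer automorphism of `Π^tp_Y[μ₃]` is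
trivial, so reached.  [cite: MochizukiEtTh2009, Lem 5.8 p.331 (PDF p.105)] -/
theorem kummerOutReached_toy₉ (H : toy₉.Facts) :
    letI : TopologicalSpace toy₉.PiX := toy₉.instTopPiX
    letI : TopologicalSpace (Multiplicative (ZMod 3)) := ⊥
    toy₉.KummerOutReached H H.sectionsFactor toy₉.outerActionLZ_of H.sgpCapSection H.sgpCupSection
      H.constantsEqNormalizer ∅ env₉ (ContinuousMulEquiv.refl _) muEquiv₉ identifiesPiY_toy₉
      cyclotomicCharacterCompatX_toy₉.toY := by
  letI : TopologicalSpace toy₉.PiX := toy₉.instTopPiX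
  letI : TopologicalSpace (Multiplicative (ZMod 3)) := ⊥
  rintro o ⟨δ, hδ, hc, rfl⟩
  rw [kummerShift_eq_one δ hδ hc]
  exact one_mem _

/-- The constants `(O_K^×)^{1/N} = μ_3(B_N)` act on `E^Π_N` by INNER automorphisms. [cite: MochizukiEtTh2009, Lem 5.8 p.331 (PDF p.105)] -/
theorem conjOut_const_eq_one (u : Aut toy₉.BN) (hu : u ∈ toy₉.OKxRootN)
    (hn : ((u, 1) : Aut toy₉.BN × toy₉.PiX) ∈ Subgroup.normalizer (toy₉.EPiN : Set (Aut toy₉.BN × toy₉.PiX))) :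
    toy₉.conjOut ⟨(u, 1), hn⟩ = 1 := by
  refine (QuotientGroup.eq_one_iff _).mpr ?_
  rw [Subgroup.mem_subgroupOf]
  refine ⟨toy₉.muIncl ⟨u, mem_muTorsion_of_mem_OKxRootN_toy₉ hu⟩, ?_⟩
  apply MulEquiv.ext
  intro x
  apply Subtype.ext
  rfl

/-- **`ConstOutTransported` at toy no. 9 with `DK := ∅`**. [cite: MochizukiEtTh2009, Lem 5.8 p.331 (PDF p.105)] -/
theorem constOutTransported_toy₉ (H : toy₉.Facts) :
    letI : TopologicalSpace toy₉.PiX := toy₉.instTopPiX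
    letI : TopologicalSpace (Multiplicative (ZMod 3)) := ⊥
    toy₉.ConstOutTransported H H.constantsEqNormalizer ∅ env₉ (ContinuousMulEquiv.refl _) muEquiv₉
      identifiesPiY_toy₉ cyclotomicCharacterCompatX_toy₉.toY := by
  letI : TopologicalSpace toy₉.PiX := toy₉.instTopPiX
  letI : TopologicalSpace (Multiplicative (ZMod 3)) := ⊥
  rintro _ ⟨o, ho | ho, rfl⟩
  · obtain ⟨u, rfl⟩ := ho
    dsimp only
    rw [conjOut_const_eq_one _ u.2, map_one]
    exact one_mem _
  · exact ho.elim

/-- **F-0545 `EnvIsoBiTheta` at toy no. 9** (abc-iut-L2-t11's `envIsoBiTheta_of` BY NAME, every binder a theorem here):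
"an isomorphism of topological groups `E^Π_N ⥲ Π^tp_Y[μ_N]` which is an isomorphism of mod `N` bi-theta environments",
with the theta section built from the NON-TRIVIAL class `η₉`.  [cite: MochizukiEtTh2009, Lem 5.9 (iv) p.332 (PDF p.106)] -/
theorem envIsoBiTheta_toy₉ (H : toy₉.Facts) :
    letI : TopologicalSpace toy₉.PiX := toy₉.instTopPiX
    letI : TopologicalSpace (Multiplicative (ZMod 3)) := ⊥
    toy₉.EnvIsoBiTheta H.sectionsFactor toy₉.outerActionLZ_of H.sgpCapSection H.sgpCupSection
      H.constantsEqNormalizer ∅ env₉ (ContinuousMulEquiv.refl _) :=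
  letI : TopologicalSpace toy₉.PiX := toy₉.instTopPiX
  letI : TopologicalSpace (Multiplicative (ZMod 3)) := ⊥
  toy₉.envIsoBiTheta_of H H.sectionsFactor toy₉.outerActionLZ_of H.sgpCapSection H.sgpCupSection
    H.constantsEqNormalizer ∅ env₉ _ muEquiv₉ identifiesPiY_toy₉ identifiesPiYdd_toy₉
    cyclotomicCharacterCompatX_toy₉ (Set.mem_singleton _) (thetaSectionCompat_toy₉ H)
    (constOutTransported_toy₉ H) (kummerOutReached_toy₉ H)

/-- **F-0546 `FrdIsMonoThetaEnv` at toy no. 9**: the Frobenioid-theoretic data IS a mod `3` mono-theta environment for the §2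
datum with non-trivial theta class.  [cite: MochizukiEtTh2009, Lem 5.9 (iv) p.332 (PDF p.106)] -/
theorem frdIsMonoThetaEnv_toy₉ (H : toy₉.Facts) :
    toy₉.FrdIsMonoThetaEnv H.sectionsFactor toy₉.outerActionLZ_of H.sgpCapSection H.sgpCupSection
      H.constantsEqNormalizer ∅ env₉ :=
  letI : TopologicalSpace toy₉.PiX := toy₉.instTopPiX
  letI : TopologicalSpace (Multiplicative (ZMod 3)) := ⊥
  toy₉.frdIsMonoThetaEnv_of _ _ _ _ _ _ env₉ (ContinuousMulEquiv.refl _) (envIsoBiTheta_toy₉ H)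

/-! ### The joint witness with a NON-TRIVIAL theta class -/

/-- **The §5 ↔ §2 dictionary of Lemma 5.9 (iv) is jointly satisfiable WITH A NON-TRIVIAL THETA CLASS.**  At toy no. 9
(`Aut_C(B_N) = ℤ/9 ⋊ (ℤ/3 × ℤˣ)`, `O^×(B_N) = ℤ/9 ⊋ μ_3(B_N) = 3ℤ/9`, `s^⊔_N := w ≠ s^⊓_N := id`, `ρ₀ = (b mod 3, sign τ)`)
paired with §2 datum no. 9 (`G_K = ℤˣ`, inversion character, `η̈^Θ mod 3 = {η₉}`, `η₉ = b mod 3`), for `ι := id`,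
`m := muEquiv₉`: `Facts`, `IdentifiesPiY`, `IdentifiesPiYdd`, **`CyclotomicCharacterCompatX`** (F-1306; so F-1307), the
character NON-TRIVIAL, **`ThetaSectionCompat` for `η₉`** (F-0521) where `η₉` is NOT a coboundary and the bi-Kummer
difference cocycle, `ρ|_{Π^tp_Ÿ̲}`, `s^⊔-gp_N·s^⊓-gp_N⁻¹`, `s^⊔_N·s^⊓_N⁻¹` are ALL non-trivial, **`ConstOutTransported`** and
**`KummerOutReached`** with `DK := ∅` (F-0520), and consequently abc-iut-L2-t4's **`EnvIsoBiTheta`** (F-0545) and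
**`FrdIsMonoThetaEnv`** (F-0546).  Answers the second-read note on abc-iut-f-116's `exists_dictionaryJointWitness`
(toy no. 3: `ρ` kills `Π^tp_Ÿ̲`, theta class forced trivial).  A consistency / non-vacuity witness for OUR typed
hypothesis list; asserts nothing about [EtTh].  [cite: MochizukiEtTh2009, Lem 5.9 (iv) p.332 (PDF p.106)] -/
theorem exists_dictionaryThetaClassWitness :
    letI : TopologicalSpace toy₉.PiX := toy₉.instTopPiX
    letI : TopologicalSpace (Multiplicative (ZMod 3)) := ⊥
    ∃ (H : toy₉.Facts) (ι : toy₉.PiX ≃ₜ* env₉.PiX) (m : toy₉.muTorsion toy₉.BN toy₉.N ≃* env₉.mu)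
      (hY : toy₉.IdentifiesPiY env₉ ι.toMulEquiv) (hYdd : toy₉.IdentifiesPiYdd env₉ ι.toMulEquiv)
      (hχX : toy₉.CyclotomicCharacterCompatX env₉ ι.toMulEquiv m)
      (η : env₉.PiYdd → env₉.mu) (_ : η ∈ env₉.thetaCocycles),
      toy₉.CyclotomicCharacterCompat env₉ ι.toMulEquiv m ∧
      Fintype.card env₉.mu = 3 ∧
      (∃ g : toy₉.PiX, g ∈ toy₉.PiY ∧ ∀ x : env₉.mu, env₉.chi (env₉.aug (ι g)) x = x⁻¹) ∧
      toy₉.ThetaSectionCompat H env₉ ι.toMulEquiv m hYdd η ∧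
      (∀ c : env₉.mu, η ≠ CycEnvelope.coboundary (env₉.aug.comp env₉.PiYdd.subtype) env₉.chi c) ∧
      (∃ y : toy₉.PiYdd, toy₉.ρ (y : toy₉.PiX) ≠ 1 ∧ η ⟨ι y, (hYdd y).mp y.2⟩ ≠ 1 ∧ toy₉.diffCocycle H y ≠ 1) ∧
      (∃ h : toy₉.HB, toy₉.sgpCup h ≠ toy₉.sgpCap (h : Aut (toy₉.base.obj toy₉.BN))) ∧
      toy₉.sCup ≠ toy₉.sCap ∧
      toy₉.ConstOutTransported H H.constantsEqNormalizer ∅ env₉ ι m hY hχX.toY ∧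
      toy₉.KummerOutReached H H.sectionsFactor toy₉.outerActionLZ_of H.sgpCapSection H.sgpCupSection
        H.constantsEqNormalizer ∅ env₉ ι m hY hχX.toY ∧
      toy₉.EnvIsoBiTheta H.sectionsFactor toy₉.outerActionLZ_of H.sgpCapSection H.sgpCupSection
        H.constantsEqNormalizer ∅ env₉ ι ∧
      toy₉.FrdIsMonoThetaEnv H.sectionsFactor toy₉.outerActionLZ_of H.sgpCapSection H.sgpCupSection
        H.constantsEqNormalizer ∅ env₉ := by
  letI : TopologicalSpace toy₉.PiX := toy₉.instTopPiX
  letI : TopologicalSpace (Multiplicative (ZMod 3)) := ⊥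
  refine ⟨facts_toy₉, ContinuousMulEquiv.refl _, muEquiv₉, identifiesPiY_toy₉, identifiesPiYdd_toy₉,
    cyclotomicCharacterCompatX_toy₉, ⇑eta₉Hom, Set.mem_singleton _, cyclotomicCharacterCompatX_toy₉.toY,
    (by change Fintype.card (Multiplicative (ZMod 3)) = 3; rw [Fintype.card_multiplicative, ZMod.card]),
    ?_, thetaSectionCompat_toy₉ facts_toy₉, eta₉_ne_coboundary,
    ⟨⟨((1, (Multiplicative.ofAdd 1, 1)) : Pi), yOne_mem⟩, rho_yOne_ne_one, eta₉_yOne_ne_one, diffCocycle_yOne_ne_one facts_toy₉⟩,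
    exists_sgpCup_ne_sgpCap, sCup_ne_sCap, constOutTransported_toy₉ facts_toy₉, kummerOutReached_toy₉ facts_toy₉,
    envIsoBiTheta_toy₉ facts_toy₉, frdIsMonoThetaEnv_toy₉ facts_toy₉⟩
  -- non-degeneracy of the character: at `x₋ = (0, 0, (0 1)) ∈ Π^tp_Y̲`, `χ(aug x₋)` inverts `μ₃`
  refine ⟨((1, (1, Equiv.swap 0 1)) : Pi), xNeg_mem, fun x => ?_⟩
  have hsign : Equiv.Perm.sign (s3 ((1, (1, Equiv.swap 0 1)) : Pi)) = -1 := Equiv.Perm.sign_swap (show (0 : Fin 3) ≠ 1 by decide)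
  change x ^ (((Equiv.Perm.sign (s3 ((1, (1, Equiv.swap 0 1)) : Pi))) : ℤ)) = x⁻¹
  rw [hsign, Units.val_neg, Units.val_one, zpow_neg_one]

end Toy

end ThetaFrobenioid

end Literature.AnabelianGeometry.EtaleTheta
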